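import Mathlib
import Literature.NumberTheory.LFunctions.RiemannXi
import Literature.Analysis.Complex.JensenPolynomialHyperbolicity

/-!
# The known hyperbolicity region of the Jensen–Pólya programme does not reach `n = 0`

Pólya's criterion (`Literature.NumberTheory.LFunctions.polya_jensen`, proved in the tree):
`RiemannHypothesis ↔ ∀ d, J^{d,0}_γ` hyperbolic, `γ` the Taylor sequence of `Ξ`
(`ξ(1/2 + z) = Σ γ(n) z^{2n} / n!`). What is known for that `γ` is a region of the
`(d, n)`-quadrant of the shape

* `n ≥ N(d)` for every `d` (Griffin–Ono–Rolen–Zagier, PNAS 116 (2019), Thm 1),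
* all `n` for `d ≤ 8` (ibid. Thm 2), and
* `n = 0` for `d ≤ K₀` with `K₀` of the order `10^17` (numerical RH; Chasse, quoted ibid.).

This file computes, in closed form, ALL Jensen polynomials of the Taylor sequences of the entire
functions `F_{b,c}(x) = (x² + b x + c) eˣ`, namely `γ(m) = m² + (b − 1) m + c`, and reads off an exact
hyperbolicity criterion: for `d ≥ 2`, `b ≥ 0`, `c > 0`,

  `J^{d,n}_γ` hyperbolic `⟺ d · (b² − 4c + 4n) + 4 (c + b n + n (n − 1)) ≥ 0`.

(`b² − 4c + 4n` is the discriminant of `p_n` where `F_{b,c}^{(n)} = p_n eˣ`; it grows by `4` with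
each shift, which is the Pólya–Wiman phenomenon — differentiation only loses non-real zeros — in
its most elementary instance.) Three kernel-checked consequences:

1. `soloBlind_jensen_shift_noGo` (`b = 0, c = 1`, the function `(1 + x²) eˣ`): all `J^{d,n}`,
   `n ≥ 1`, are hyperbolic in every degree, yet `J^{2,0} = 3X² + 2X + 1` is not. So the conclusion
   shape of GORZ Thm 1 — even with `N(d) = 1` uniformly in `d` — is consistent with non-real zeros.
2. `soloBlind_jensen_threshold_noGo` (`b = 0, c = N`): for EVERY prescribed threshold `N`,
   "hyperbolic for all `d` and all `n ≥ N`" holds while for each `n < N` hyperbolicity fails in all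
   large degrees `d`. No uniform-threshold statement is a rung toward shift `0`.
3. `soloBlind_jensen_ray_witness` (`b = 2√(K−1), c = K`): for EVERY `K ≥ 1` there is a real sequence
   whose Jensen polynomials are hyperbolic at exactly the pairs `(d, n) ∉ {0} × (K, ∞)`: all shifts
   `n ≥ 1` in all degrees, and shift `0` precisely up to degree `K`. Taking `K ≥ max(8, K₀)`, this
   sequence satisfies every hyperbolicity statement presently known for the Riemann `Ξ`-sequence,
   read as a condition on an abstract real sequence, and still violates the Pólya–Jensen criterion.

Reading: inside the Jensen–Pólya programme the entire content of RH is the ray `n = 0, d → ∞`;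
results in the shift direction, of any strength and uniformity, do not bear on it unless they use
properties of the `Ξ`-sequence beyond those shared with `m² + (b−1)m + c`.

Soloist artefact `solo-RiemannHypothesis-blind`, sessions 1–2 (2026-08-17).
-/

open Polynomial

namespace Summit.RiemannHypothesis.RiemannHypothesis.Theorems

open Literature.NumberTheory.LFunctions (jensenPoly)
open Literature.Analysis.Complex.PolyaSchur

/-- Binomial bookkeeping: `d · C(d−1, j−1) = j · C(d, j)` in the `ite`-form produced by
`coeff_X_pow_mul'` (all `d, j : ℕ`, casts in `ℝ`). [folklore] -/
theorem soloBlind_choose_aux₁ (d j : ℕ) :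
    (d : ℝ) * (if 1 ≤ j then (((d - 1).choose (j - 1) : ℕ) : ℝ) else 0)
      = (j : ℝ) * (d.choose j : ℝ) := by
  rcases j with _ | j
  · simp
  · rw [if_pos (Nat.succ_le_succ (Nat.zero_le _)), Nat.add_sub_cancel]
    rcases d with _ | d
    · simp
    · rw [Nat.add_sub_cancel]
      have h' : ((d : ℝ) + 1) * (d.choose j : ℝ) = ((d + 1).choose (j + 1) : ℝ) * ((j : ℝ) + 1) := by
        exact_mod_cast Nat.add_one_mul_choose_eq d j
      push_cast
      linear_combination h'

/-- Binomial bookkeeping: `d (d−1) · C(d−2, j−2) = j (j−1) · C(d, j)` in `ite`-form (all `d, j : ℕ`,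
casts in `ℝ`). [folklore] -/
theorem soloBlind_choose_aux₂ (d j : ℕ) :
    (d : ℝ) * ((d : ℝ) - 1) * (if 2 ≤ j then (((d - 2).choose (j - 2) : ℕ) : ℝ) else 0)
      = (j : ℝ) * ((j : ℝ) - 1) * (d.choose j : ℝ) := by
  rcases j with _ | _ | j
  · simp
  · simp
  · rw [if_pos (by omega), (by omega : j + 1 + 1 - 2 = j)]
    rcases d with _ | _ | d
    · simp
    · simp [Nat.choose_eq_zero_of_lt (by omega : 1 < j + 1 + 1)]
    · rw [(by omega : d + 1 + 1 - 2 = d)]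
      have h1 : ((d : ℝ) + 1) * (d.choose j : ℝ) = ((d + 1).choose (j + 1) : ℝ) * ((j : ℝ) + 1) := by
        exact_mod_cast Nat.add_one_mul_choose_eq d j
      have h2 : ((d : ℝ) + 1 + 1) * ((d + 1).choose (j + 1) : ℝ)
          = ((d + 1 + 1).choose (j + 1 + 1) : ℝ) * ((j : ℝ) + 1 + 1) := by
        exact_mod_cast Nat.add_one_mul_choose_eq (d + 1) (j + 1)
      push_cast
      linear_combination ((d : ℝ) + 2) * h1 + ((j : ℝ) + 1) * h2

/-- **Closed form of all shifted Jensen polynomials of `γ(m) = m² + (b−1) m + c`** (the Taylor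
sequence `m! [x^m] F` of `F(x) = (x² + b x + c) eˣ`): for all `d, n`,
`J^{d,n}_γ = c_n (X+1)^d + b_n d · X (X+1)^{d−1} + d (d−1) · X² (X+1)^{d−2}` with
`b_n = b + 2n`, `c_n = c + b n + n(n−1)` (so `F⁽ⁿ⁾ = (x² + b_n x + c_n) eˣ`; `ℕ`-truncated exponents,
harmless since the corresponding coefficients vanish). [folklore] -/
theorem soloBlind_jensenPoly_quadExp_eq (b c : ℝ) (d n : ℕ) :
    jensenPoly (fun m : ℕ => (m : ℝ) ^ 2 + (b - 1) * m + c) d n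
      = C (c + b * n + n * ((n : ℝ) - 1)) * (X + 1) ^ d
        + C ((b + 2 * (n : ℝ)) * d) * (X * (X + 1) ^ (d - 1))
        + C ((d : ℝ) * ((d : ℝ) - 1)) * (X ^ 2 * (X + 1) ^ (d - 2)) := by
  rw [show (X : ℝ[X]) * (X + 1) ^ (d - 1) = X ^ 1 * (X + 1) ^ (d - 1) by rw [pow_one]]
  ext j
  have e1 := soloBlind_choose_aux₁ d j
  have e2 := soloBlind_choose_aux₂ d j
  simp only [coeff_jensenPoly, coeff_add, coeff_C_mul, coeff_X_pow_mul', coeff_X_add_one_pow]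
  by_cases hj : j ≤ d
  · rw [if_pos hj]
    push_cast
    linear_combination (-(b + 2 * (n : ℝ))) * e1 - e2
  · rw [if_neg hj]
    have hC : (d.choose j : ℝ) = 0 := by
      rw [Nat.choose_eq_zero_of_lt (not_le.mp hj)]; simp
    linear_combination (-(b + 2 * (n : ℝ))) * e1 - e2
      + (-(c + b * n + n * ((n : ℝ) - 1)) - (b + 2 * n) * j - j * (j - 1)) * hC

/-- The same closed form in degree `e + 2`, factored: `J^{e+2,n}_γ = (X+1)^e · Q_n` with the
quadratic `Q_n = (c_n + b_n D + D(D−1)) X² + (2 c_n + b_n D) X + c_n`, `D = e + 2`. [folklore] -/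
theorem soloBlind_jensenPoly_quadExp_factor (b c : ℝ) (e n : ℕ) :
    jensenPoly (fun m : ℕ => (m : ℝ) ^ 2 + (b - 1) * m + c) (e + 2) n
      = (X + 1) ^ e *
        (C ((c + b * n + n * ((n : ℝ) - 1)) + (b + 2 * (n : ℝ)) * ((e : ℝ) + 2)
              + ((e : ℝ) + 2) * ((e : ℝ) + 1)) * X ^ 2
          + C ((c + b * n + n * ((n : ℝ) - 1)) + (c + b * n + n * ((n : ℝ) - 1))
              + (b + 2 * (n : ℝ)) * ((e : ℝ) + 2)) * X
          + C (c + b * n + n * ((n : ℝ) - 1))) := by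
  rw [soloBlind_jensenPoly_quadExp_eq, (by omega : e + 2 - 1 = e + 1), (by omega : e + 2 - 2 = e)]
  push_cast
  simp only [map_add, map_mul, map_sub, map_natCast, map_ofNat, map_one]
  ring

/-- A real quadratic `A X² + B X + c` with `A > 0` and non-negative discriminant is hyperbolic
(splits over `ℝ`): a non-real root `u + iv` would force `2 A u + B = 0` and then
`A v² = −(B² − 4Ac)/(4A) ≤ 0`. [folklore] -/
theorem soloBlind_quadratic_splits {A B c : ℝ} (hA : 0 < A) (hdisc : 0 ≤ B ^ 2 - 4 * A * c) :
    (C A * X ^ 2 + C B * X + C c : ℝ[X]).Splits := by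
  refine splits_of_forall_aeval_eq_zero_im_eq_zero fun z hz => ?_
  simp only [map_add, map_mul, map_pow, aeval_C, aeval_X, Complex.coe_algebraMap] at hz
  rw [pow_two] at hz
  have hre := congrArg Complex.re hz
  have him := congrArg Complex.im hz
  simp only [Complex.add_re, Complex.mul_re, Complex.ofReal_re, Complex.ofReal_im,
    Complex.add_im, Complex.mul_im, Complex.zero_re, Complex.zero_im, zero_mul, sub_zero,
    add_zero] at hre him
  by_contra hv
  have hv2 : 0 < z.im ^ 2 := by positivity
  have h0 : z.im * (2 * A * z.re + B) = 0 := by linear_combination him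
  rcases mul_eq_zero.mp h0 with h | hw
  · exact hv h
  · have hB : B = -2 * A * z.re := by linarith
    rw [hB] at hre hdisc
    have hc : c = A * z.re ^ 2 + A * z.im ^ 2 := by linear_combination hre
    rw [hc] at hdisc
    nlinarith [mul_pos (mul_pos hA hA) hv2]

/-- Conversely, a real quadratic `A X² + B X + c` with `A > 0` and negative discriminant is not
hyperbolic: a real root `x` would give `0 = 4A (A x² + B x + c) = (2 A x + B)² + (4 A c − B²) > 0`.
[folklore] -/
theorem soloBlind_quadratic_not_splits {A B c : ℝ} (hA : 0 < A) (hdisc : B ^ 2 - 4 * A * c < 0) :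
    ¬ (C A * X ^ 2 + C B * X + C c : ℝ[X]).Splits := by
  intro h
  have hdeg : (C A * X ^ 2 + C B * X + C c : ℝ[X]).degree ≠ 0 := by
    rw [degree_quadratic hA.ne']
    decide
  obtain ⟨x, hx⟩ := h.exists_eval_eq_zero hdeg
  simp only [eval_add, eval_mul, eval_C, eval_pow, eval_X] at hx
  have key : (2 * A * x + B) ^ 2 + (4 * A * c - B ^ 2) = 4 * A * (A * x ^ 2 + B * x + c) := by ring
  rw [hx, mul_zero] at key
  nlinarith [sq_nonneg (2 * A * x + B)]

/-- For a natural number `n`, `n (n − 1) ≥ 0` in `ℝ`. [folklore] -/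
theorem soloBlind_natCast_mul_sub_one_nonneg (n : ℕ) : (0 : ℝ) ≤ n * ((n : ℝ) - 1) := by
  rcases Nat.eq_zero_or_pos n with rfl | hn
  · simp
  · have h1 : (1 : ℝ) ≤ n := by exact_mod_cast hn
    nlinarith

/-- **Exact hyperbolicity criterion** for the Jensen polynomials of `γ(m) = m² + (b−1) m + c`
(`b ≥ 0`, `c > 0`) in degree `e + 2`:
`J^{e+2,n}_γ` hyperbolic `⟺ (e+2) · (b² − 4c + 4n) + 4 (c + b n + n(n−1)) ≥ 0`.
Here `b² − 4c + 4n = b_n² − 4 c_n` is the discriminant of `x² + b_n x + c_n`, which carries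
`F⁽ⁿ⁾ = (x² + b_n x + c_n) eˣ`; the discriminant of the quadratic factor `Q_n` of
`soloBlind_jensenPoly_quadExp_factor` is `D · (D (b_n² − 4c_n) + 4 c_n)`, `D = e + 2`. [folklore] -/
theorem soloBlind_jensenPoly_quadExp_splits_iff {b c : ℝ} (hb : 0 ≤ b) (hc : 0 < c) (e n : ℕ) :
    (jensenPoly (fun m : ℕ => (m : ℝ) ^ 2 + (b - 1) * m + c) (e + 2) n).Splits ↔
      0 ≤ ((e : ℝ) + 2) * (b ^ 2 - 4 * c + 4 * n) + 4 * (c + b * n + n * ((n : ℝ) - 1)) := by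
  rw [soloBlind_jensenPoly_quadExp_factor]
  set c' : ℝ := c + b * n + n * ((n : ℝ) - 1) with hc'
  set D : ℝ := (e : ℝ) + 2 with hD
  have hnn := soloBlind_natCast_mul_sub_one_nonneg n
  have hn0 : (0 : ℝ) ≤ n := by positivity
  have hc'pos : 0 < c' := by rw [hc']; nlinarith [mul_nonneg hb hn0, hnn]
  have he0 : (0 : ℝ) ≤ e := by positivity
  have hD2 : (2 : ℝ) ≤ D := by rw [hD]; linarith
  have hA : 0 < c' + (b + 2 * (n : ℝ)) * D + D * ((e : ℝ) + 1) := by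
    have h₁ : (0 : ℝ) ≤ (b + 2 * (n : ℝ)) * D := mul_nonneg (by linarith) (by linarith)
    have h₂ : (0 : ℝ) ≤ D * ((e : ℝ) + 1) := mul_nonneg (by linarith) (by linarith)
    linarith
  have hX1 : ((X : ℝ[X]) + 1).Splits :=
    Splits.of_natDegree_le_one ((natDegree_add_le _ _).trans (max_le natDegree_X_le (by simp)))
  have hX1ne : ((X : ℝ[X]) + 1) ^ e ≠ 0 := pow_ne_zero _ (by simpa using X_add_C_ne_zero (1 : ℝ))
  rw [splits_mul_iff_right hX1ne (hX1.pow e)]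
  have key : (c' + c' + (b + 2 * (n : ℝ)) * D) ^ 2 - 4 * (c' + (b + 2 * (n : ℝ)) * D + D * ((e : ℝ) + 1)) * c'
      = D * (D * (b ^ 2 - 4 * c + 4 * n) + 4 * c') := by
    rw [hc', hD]; ring
  constructor
  · intro h
    by_contra hlt
    rw [not_le] at hlt
    refine soloBlind_quadratic_not_splits hA ?_ h
    rw [key]
    have hDpos : (0 : ℝ) < D := by linarith
    exact mul_neg_of_pos_of_neg hDpos hlt
  · intro h
    refine soloBlind_quadratic_splits hA ?_
    rw [key]
    have hD0 : (0 : ℝ) ≤ D := by linarith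
    exact mul_nonneg hD0 h

/-- Degrees `d ≤ 1`: every Jensen polynomial of degree at most one is hyperbolic. [folklore] -/
theorem soloBlind_jensenPoly_splits_of_le_one (γ : ℕ → ℝ) {d : ℕ} (hd : d ≤ 1) (n : ℕ) :
    (jensenPoly γ d n).Splits :=
  Splits.of_natDegree_le_one ((natDegree_jensenPoly_le _ d n).trans hd)

/-- All shifts `n` with `b² − 4c + 4n ≥ 0` (i.e. `F⁽ⁿ⁾` already in the Laguerre–Pólya class) give
hyperbolic Jensen polynomials in every degree. [folklore] -/
theorem soloBlind_jensenPoly_quadExp_splits_of_disc_nonneg {b c : ℝ} (hb : 0 ≤ b) (hc : 0 < c)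
    (d n : ℕ) (hdisc : 0 ≤ b ^ 2 - 4 * c + 4 * n) :
    (jensenPoly (fun m : ℕ => (m : ℝ) ^ 2 + (b - 1) * m + c) d n).Splits := by
  rcases Nat.lt_or_ge d 2 with hd | hd
  · exact soloBlind_jensenPoly_splits_of_le_one _ (by omega) n
  · obtain ⟨e, rfl⟩ : ∃ e, d = e + 2 := ⟨d - 2, by omega⟩
    rw [soloBlind_jensenPoly_quadExp_splits_iff hb hc]
    have hnn := soloBlind_natCast_mul_sub_one_nonneg n
    have hn0 : (0 : ℝ) ≤ n := by positivity
    have h1 : (0 : ℝ) ≤ c + b * n + n * ((n : ℝ) - 1) := by nlinarith [mul_nonneg hb hn0]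
    have h2 : (0 : ℝ) ≤ ((e : ℝ) + 2) * (b ^ 2 - 4 * c + 4 * n) :=
      mul_nonneg (by positivity) hdisc
    linarith

/-! ### Consequence 1: the witness `(1 + x²) eˣ` of session 1 (`b = 0`, `c = 1`) -/

/-- **Every shifted Jensen polynomial of `γ(m) = m² − m + 1` with shift `n ≥ 1` is hyperbolic**
(all degrees `d`). [folklore] -/
theorem soloBlind_jensenPoly_shiftWitness_splits (d n : ℕ) (hn : 1 ≤ n) :
    (jensenPoly (fun m : ℕ => (m : ℝ) ^ 2 - m + 1) d n).Splits := by
  have e : (fun m : ℕ => (m : ℝ) ^ 2 - m + 1) = (fun m : ℕ => (m : ℝ) ^ 2 + (0 - 1) * m + 1) := by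
    funext m; ring
  rw [e]
  exact soloBlind_jensenPoly_quadExp_splits_of_disc_nonneg le_rfl one_pos d n
    (by have : (1 : ℝ) ≤ n := by exact_mod_cast hn
        linarith)

/-- **… but `J^{2,0}_γ = 3X² + 2X + 1` is not hyperbolic** (discriminant `−8`). [folklore] -/
theorem soloBlind_jensenPoly_shiftWitness_two_zero_not_splits :
    ¬ (jensenPoly (fun m : ℕ => (m : ℝ) ^ 2 - m + 1) 2 0).Splits := by
  have e : (fun m : ℕ => (m : ℝ) ^ 2 - m + 1) = (fun m : ℕ => (m : ℝ) ^ 2 + (0 - 1) * m + 1) := by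
    funext m; ring
  rw [e]
  change ¬ (jensenPoly (fun m : ℕ => (m : ℝ) ^ 2 + (0 - 1) * m + 1) (0 + 2) 0).Splits
  rw [soloBlind_jensenPoly_quadExp_splits_iff le_rfl one_pos 0 0]
  push_cast
  norm_num

/-- **No-go for the shift direction of the Jensen–Pólya programme.** There is a real sequence
`γ` all of whose Jensen polynomials `J^{d,n}_γ` with `n ≥ 1` are hyperbolic — for every degree
`d`, i.e. the conclusion of GORZ 2019 Thm 1 holds with `N(d) = 1` uniformly in `d` — while the
Pólya–Jensen condition at shift `0` (`∀ d`, `J^{d,0}_γ` hyperbolic, which for `γ = ` the Taylor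
sequence of `Ξ` IS the Riemann Hypothesis by `polya_jensen`) fails. [folklore] -/
theorem soloBlind_jensen_shift_noGo :
    ∃ γ : ℕ → ℝ, (∀ d n : ℕ, 1 ≤ n → (jensenPoly γ d n).Splits) ∧ ¬ (∀ d : ℕ, (jensenPoly γ d 0).Splits) :=
  ⟨fun m : ℕ => (m : ℝ) ^ 2 - m + 1, fun d n hn => soloBlind_jensenPoly_shiftWitness_splits d n hn,
    fun h => soloBlind_jensenPoly_shiftWitness_two_zero_not_splits (h 2)⟩

/-! ### Consequence 2: no uniform threshold (`b = 0`, `c = N`, the functions `(x² + N) eˣ`) -/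

/-- **Uniform-threshold no-go.** For every `N` there is a real sequence whose Jensen polynomials
`J^{d,n}` are hyperbolic for all degrees `d` and all shifts `n ≥ N`, while for every shift `n < N`
hyperbolicity fails in some degree (in fact in every degree `d > (n² − n + N)/(N − n)`). Hence no
statement "hyperbolic for all `d` and all `n ≥ N`", whatever `N ≥ 1`, implies anything at smaller
shifts. Witness: `γ(m) = m² − m + N`, the Taylor sequence of `(x² + N) eˣ`. [folklore] -/
theorem soloBlind_jensen_threshold_noGo (N : ℕ) :
    ∃ γ : ℕ → ℝ, (∀ d n : ℕ, N ≤ n → (jensenPoly γ d n).Splits) ∧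
      (∀ n : ℕ, n < N → ∃ d : ℕ, ¬ (jensenPoly γ d n).Splits) := by
  rcases Nat.eq_zero_or_pos N with rfl | hN
  · -- `N = 0`: any Laguerre–Pólya witness will do, e.g. `(x + 1)² eˣ` (`b = 2`, `c = 1`).
    refine ⟨fun m : ℕ => (m : ℝ) ^ 2 + (2 - 1) * m + 1, fun d n _ => ?_, fun n hn => absurd hn (by omega)⟩
    exact soloBlind_jensenPoly_quadExp_splits_of_disc_nonneg (by norm_num) one_pos d n
      (by have : (0 : ℝ) ≤ n := by positivity
          nlinarith)
  have hNpos : (0 : ℝ) < N := by exact_mod_cast hN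
  refine ⟨fun m : ℕ => (m : ℝ) ^ 2 + (0 - 1) * m + N, fun d n hn => ?_, fun n hn => ?_⟩
  · exact soloBlind_jensenPoly_quadExp_splits_of_disc_nonneg le_rfl hNpos d n
      (by have : (N : ℝ) ≤ n := by exact_mod_cast hn
          nlinarith)
  · -- degree `e + 2` with `e = n² + N`: then `(e+2)(4n − 4N) + 4(N + n(n−1)) < 0`
    refine ⟨n ^ 2 + N + 2, ?_⟩
    rw [soloBlind_jensenPoly_quadExp_splits_iff le_rfl hNpos]
    push_cast
    have h1 : (n : ℝ) + 1 ≤ N := by exact_mod_cast hn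
    have hn0 : (0 : ℝ) ≤ n := by positivity
    intro h
    nlinarith [mul_nonneg (by positivity : (0 : ℝ) ≤ (n : ℝ) ^ 2 + N + 2) (by linarith : (0 : ℝ) ≤ (N : ℝ) - n - 1)]

/-! ### Consequence 3: a witness for the whole known region (`b = 2√(K−1)`, `c = K`) -/

/-- **Ray witness.** For every `K ≥ 1` there is a real sequence whose Jensen polynomials `J^{d,n}`
are hyperbolic for all `n ≥ 1` in every degree, and at shift `n = 0` are hyperbolic EXACTLY in the
degrees `d ≤ K`. Witness: `γ(m) = m² + (2√(K−1) − 1) m + K`, the Taylor sequence of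
`((x + √(K−1))² + 1) eˣ` (zeros `−√(K−1) ± i`). With `K` at least the largest degree to which
`J^{d,0}` of the Riemann `Ξ`-sequence has been verified (and `K ≥ 8`), this sequence satisfies every
hyperbolicity statement currently known for `Ξ` — GORZ Thm 1 (each `d`, large `n`), Thm 2 (`d ≤ 8`,
all `n`), numerical shift-`0` results — read as conditions on a real sequence, and violates the
Pólya–Jensen criterion `∀ d, J^{d,0}` hyperbolic. [folklore] -/
theorem soloBlind_jensen_ray_witness (K : ℕ) (hK : 1 ≤ K) :
    ∃ γ : ℕ → ℝ, (∀ d n : ℕ, 1 ≤ n → (jensenPoly γ d n).Splits) ∧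
      (∀ d : ℕ, (jensenPoly γ d 0).Splits ↔ d ≤ K) := by
  set b : ℝ := 2 * Real.sqrt ((K : ℝ) - 1) with hb
  have hK1 : (1 : ℝ) ≤ K := by exact_mod_cast hK
  have hsq : Real.sqrt ((K : ℝ) - 1) ^ 2 = (K : ℝ) - 1 := Real.sq_sqrt (by linarith)
  have hb0 : 0 ≤ b := by rw [hb]; positivity
  have hKpos : (0 : ℝ) < K := by linarith
  have hdisc : b ^ 2 - 4 * K = -4 := by rw [hb]; nlinarith [hsq]
  refine ⟨fun m : ℕ => (m : ℝ) ^ 2 + (b - 1) * m + K, fun d n hn => ?_, fun d => ?_⟩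
  · exact soloBlind_jensenPoly_quadExp_splits_of_disc_nonneg hb0 hKpos d n
      (by have : (1 : ℝ) ≤ n := by exact_mod_cast hn
          linarith)
  · rcases Nat.lt_or_ge d 2 with hd | hd
    · exact ⟨fun _ => by omega, fun _ => soloBlind_jensenPoly_splits_of_le_one _ (by omega) 0⟩
    · obtain ⟨e, rfl⟩ : ∃ e, d = e + 2 := ⟨d - 2, by omega⟩
      rw [soloBlind_jensenPoly_quadExp_splits_iff hb0 hKpos]
      push_cast
      simp only [mul_zero, add_zero, zero_mul, hdisc]
      constructor
      · intro h
        have : (e : ℝ) + 2 ≤ K := by linarith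
        exact_mod_cast this
      · intro h
        have : (e : ℝ) + 2 ≤ K := by exact_mod_cast h
        linarith

/-- **Known-region no-go (headline).** For every `K`: hyperbolicity of `J^{d,n}` for all `n ≥ 1` and
all `d`, together with hyperbolicity of `J^{d,0}` for all `d ≤ K`, does not imply the Pólya–Jensen
criterion `∀ d, J^{d,0}` hyperbolic. (For the Riemann `Ξ`-sequence the latter is RH by
`polya_jensen`; everything presently known about its Jensen polynomials is contained in a region of
the former shape.) [folklore] -/
theorem soloBlind_jensen_knownRegion_noGo (K : ℕ) :
    ∃ γ : ℕ → ℝ, (∀ d n : ℕ, 1 ≤ n → (jensenPoly γ d n).Splits) ∧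
      (∀ d : ℕ, d ≤ K → (jensenPoly γ d 0).Splits) ∧ ¬ (∀ d : ℕ, (jensenPoly γ d 0).Splits) := by
  obtain ⟨γ, h1, h2⟩ := soloBlind_jensen_ray_witness (K + 1) (by omega)
  exact ⟨γ, h1, fun d hd => (h2 d).2 (by omega), fun h => by have := (h2 (K + 2)).1 (h _); omega⟩

end Summit.RiemannHypothesis.RiemannHypothesis.Theorems
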